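/-
Origin: expansion seat `planner-pub-hodgecm-pv07-g2-0`, handover #1 v2 2026-08-18T06:09:22Z (`HOME/pub-hodgecm-pv07-g2/lean/Pv07g2/DilationModel.lean`, md5 2b6401f6, 455 lines);
landed by the gen-6 packager in gate run 24 as `HodgeCM/PerL34/LocalFactors/DilationModel.lean` (verbatim).
-/
/-
Copyright: HodgeCM publication cell (pub-hodgecm), DAG node N31f (prover lineage pv07; this file: pv07 gen 2,
session planner-pub-hodgecm-pv07-g2-0, 2026-08-18).  Released under the package licence.
Intended final place: `HodgeCM/PerL34/LocalFactors/DilationModel.lean`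
(namespace `HodgeCM.PerL34.LocalFactors.DilationModel`).  Imports: the landed `LocalFactors.PiecesSplit` (+ one
Mathlib file it already reaches transitively).  KERNEL only: nothing cited, nothing asserted, no placeholders.

# The split local model, CONSTRUCTED: the unitary dilation representation of `Fˣ` on `L²(Fⁿ)`

PerL v5, proof of Lemma 4.2(b), tex ll. 610–611 (verbatim): at a place `v` of `L₀` split in `L` the group
`U(W_i)(L_{0,v})` "is `L_{0,v}^×` acting on `𝒮(L_{0,v}^3)` by `(ω(y)φ)(x)=|y|^{3/2}φ(yx)` up to a unitary
character"; l. 613 / ll. 621–623: `m(y) = ⟨ω_v(y)φ_v, φ_v⟩ = vol(D ∩ y⁻¹D)` for `φ_v = 1_D`.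

Up to gate run 22 the package carried this model only through the EQUATION it implies for the chosen vector
(`LocalFactors.HasSplitModel`, field `coeff_eq : ⟪φ, ω(y)φ⟫ = ballCoeff a μ x₀ r (e y)`, GAPS pv07-G1 = pv10-G1:
"D4", an `ω` and a weight `a` about which nothing but this equation is known).  This file BUILDS the model:

§1 (general: a commutative group `G` acting distributively and continuously on a locally compact additive group
`X` with additive Haar measure `μ`; PerL: `G = Fˣ`, `X = F³`, `μ = dx`, `F = L_{0,v}`):
* `weight X ν g = ν(g) · δ(g)^{1/2}`, `δ = distribHaarChar X : G →* ℝ≥0` (Mathlib; `μ (g • s) = δ(g) μ s`, so on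
  `Fⁿ` `δ` is the module `|y|ⁿ` of the tex and `δ^{1/2} = |y|^{3/2}` for `n = 3`), `ν : G →* Circle` the
  "unitary character";
* `dilate μ ν g : Lp ℂ 2 μ ≃ₗᵢ[ℂ] Lp ℂ 2 μ`, `(dilate μ ν g f)(x) = weight ν g · f(g • x)` a.e. (`coeFn_dilateFun`)
  — linear, UNITARY (`norm_dilateFun`: the factor `δ^{1/2}` is exactly what makes it isometric, by the change of
  variables `map_smul_eq : μ ∘ (g•)⁻¹ = δ(g)⁻¹ μ`), invertible (`dilateFun_inv_apply`);
* `dilationRep μ ν : G →* (Lp ℂ 2 μ ≃ₗᵢ[ℂ] Lp ℂ 2 μ)` — a unitary representation (`dilateFun_mul`, `dilateFun_one`;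
  `G` commutative, as `Fˣ` is, so PerL's convention `φ(yx)` is a homomorphism);
* `inner_indicator_dilationRep : ⟪1_A, ω(g) 1_A⟫ = weight ν g · μ.real (A ∩ (g•)⁻¹A)` for every measurable `A` of
  finite measure (Mathlib `L2.inner_indicatorConstLp_one_indicatorConstLp_one`) — with `A = D = closedBall x₀ r`
  the right-hand side is LITERALLY pv07's `ballCoeff (weight) μ x₀ r` (tex "m(y)·|y|^{3/2}·ν").

§2 (`F` a locally compact ultrametric normed field, `X = Fin n → F`, `G = Fˣ`):
* `distribHaarChar_eq_one_of_norm_eq_one : ‖y‖ = 1 → δ(y) = 1` (tex l. 620 "`|y|^{3/2} ≡ 1` on `U₁`");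
* `splitIntegrand μV x₀ r μG ν χ' : EulerFactorisation.LocalIntegrand` — the HONEST datum at a split place:
  `G = Fˣ` with ANY regular Haar measure `μG = d^×y` (inversion-invariant: instance, `Fˣ` commutative),
  `Sp = L²(Fⁿ, μV)`, `ω = dilationRep μV ν`, `φ = 1_D` (`ballIndicator`), `χ = χ'` (`splitIntegrand_f`: its integrand
  is `ν(y)|y|^{n/2} vol(D ∩ y⁻¹D) χ'(y)`);
* `hasSplitModel_splitIntegrand : 0 < r < ‖x₀‖ → ν|U₁ = 1 → χ'|U₁ = 1 → HasSplitModel (splitIntegrand …)` —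
  `HasSplitModel` is now a THEOREM for a constructed datum: the model equation (`splitIntegrand_coeff_eq`),
  measurability, and `0 < vol^×(U₁) < ∞` (`U₁` open, and compact in `Fˣ`: `isCompact_val_preimage_U1`) are all
  discharged; hence `splitIntegrand_I_pos : 0 < I_v` by the landed `loc_I_pos_of_hasSplitModel`
  ("N large ⇒ ν, χ' trivial on U₁" is the landed `KernelRadius.exists_radius_forall_U1_eq_one`);
* `hasSplitModel_of_coeff` — TRANSFER to ANY datum `L` (e.g. N31h's canonical `PureTensor.localIntegrand … v`,
  global space, `ω ∘ ι_v`, pure tensor `φ`): if `⟪L.φ, L.ω y L.φ⟫ = c · ⟪1_D, dilationRep ν (t y) 1_D⟫` for a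
  constant `c > 0` and a measurable identification `t : L.G → Fˣ` with `0 < L.μ(t⁻¹U₁) < ∞`, then
  `HasSplitModel L`.  Its hypothesis `hcoeff` is the EXACT kernel reading of the residual PRINT sentence.

RESIDUAL after this file (LEMMAS §3 D4, PRINT — unchanged in kind, sharpened in form): "PerL's `ω_v|U(W_i)` at a
split `v` (the Weil representation of `U(V) × U(W_i)` restricted) has, on the chosen pure tensor, the matrix
coefficient of `dilationRep ν_v` at `1_D`" — Mœglin–Vignéras–Waldspurger, LNM 1291, ch. 3 §III.1 (the mixed
model at a split place; `m = 1`, `m' = 3`); S. Kudla, Notes on the local theta correspondence (1996), III Rem. 6.3;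
Gelbart–Piatetski-Shapiro–Rallis, LNM 1254, Part B §4.2.  The conventions `φ(yx)` / `φ(y⁻¹x)` differ by `y ↦ y⁻¹`,
immaterial for `I_v` (`LocalIntegrand.integral_real`; `d^×y` inversion-invariant).
-/
import Summits.HodgeConjecture.HodgeCM.PerL34.LocalFactors.PiecesSplit
import Mathlib.MeasureTheory.Measure.Haar.DistribChar

set_option autoImplicit false

noncomputable section

open MeasureTheory MeasureTheory.Measure Set Metric Complex ComplexConjugate
open scoped ENNReal NNReal Pointwise InnerProductSpace

namespace HodgeCM
namespace PerL34
namespace LocalFactors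
namespace DilationModel

/-! ## §1  The dilation operators on `L²(X, μ)` (a distributive action on an additive group with Haar measure) -/

section General

variable {G : Type*} [CommGroup G] {X : Type*} [AddCommGroup X] [DistribMulAction G X]
  [TopologicalSpace X] [IsTopologicalAddGroup X] [LocallyCompactSpace X] [ContinuousConstSMul G X]
  [MeasurableSpace X] [BorelSpace X] (μ : Measure X) [μ.IsAddHaarMeasure] [μ.Regular]

/-- change of variables: pushing `μ` along `x ↦ g • x` divides it by the module, `μ ∘ (g•)⁻¹ = δ(g)⁻¹ • μ`. -/
theorem map_smul_eq (g : G) : μ.map (fun x : X => g • x) = ((distribHaarChar X g)⁻¹ : ℝ≥0) • μ := by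
  ext s hs
  rw [Measure.map_apply (measurable_const_smul g) hs, Set.preimage_smul, Measure.coe_nnreal_smul_apply,
    ← map_inv, distribHaarChar_mul μ g⁻¹ s]

/-- `μ((g•)⁻¹ s) = δ(g)⁻¹ μ(s)` -/
theorem measure_preimage_smul_eq (g : G) (s : Set X) :
    μ ((fun x : X => g • x) ⁻¹' s) = (distribHaarChar X g)⁻¹ * μ s := by
  rw [Set.preimage_smul, ← map_inv, distribHaarChar_mul μ g⁻¹ s]

/-- (Ported verbatim from the HodgeCMPerL package; no docstring in the source.) -/
theorem measure_preimage_smul_ne_top (g : G) {s : Set X} (hs : μ s ≠ ⊤) :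
    μ ((fun x : X => g • x) ⁻¹' s) ≠ ⊤ := by
  rw [measure_preimage_smul_eq]; exact ENNReal.mul_ne_top ENNReal.coe_ne_top hs

/-- (Ported verbatim from the HodgeCMPerL package; no docstring in the source.) -/
theorem quasiMeasurePreserving_smul' (g : G) : QuasiMeasurePreserving (fun x : X => g • x) μ μ := by
  refine ⟨measurable_const_smul g, ?_⟩
  rw [map_smul_eq μ g]
  exact Measure.smul_absolutelyContinuous

variable (X) in
/-- the weight `ν(g) · δ(g)^{1/2}` of the dilation operator (tex: "`|y|^{3/2}`… up to a unitary character") -/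
def weight (ν : G →* Circle) (g : G) : ℂ := (ν g : ℂ) * ((NNReal.sqrt (distribHaarChar X g) : ℝ) : ℂ)

omit [MeasurableSpace X] [BorelSpace X] in
/-- (Ported verbatim from the HodgeCMPerL package; no docstring in the source.) -/
theorem nnnorm_weight (ν : G →* Circle) (g : G) : ‖weight X ν g‖₊ = NNReal.sqrt (distribHaarChar X g) := by
  rw [weight, nnnorm_mul, ← norm_toNNReal, Circle.norm_coe, Real.toNNReal_one, one_mul,
    Complex.nnnorm_real, NNReal.nnnorm_eq]

omit [MeasurableSpace X] [BorelSpace X] in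
/-- (Ported verbatim from the HodgeCMPerL package; no docstring in the source.) -/
theorem weight_mul (ν : G →* Circle) (g h : G) : weight X ν (g * h) = weight X ν g * weight X ν h := by
  simp only [weight, map_mul, Circle.coe_mul, NNReal.sqrt_mul, NNReal.coe_mul, Complex.ofReal_mul]
  ring

omit [MeasurableSpace X] [BorelSpace X] in
/-- (Ported verbatim from the HodgeCMPerL package; no docstring in the source.) -/
theorem weight_one (ν : G →* Circle) : weight X ν 1 = 1 := by
  simp [weight]

omit [MeasurableSpace X] [BorelSpace X] in
/-- (Ported verbatim from the HodgeCMPerL package; no docstring in the source.) -/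
theorem weight_inv_mul_self (ν : G →* Circle) (g : G) : weight X ν g⁻¹ * weight X ν g = 1 := by
  rw [← weight_mul, inv_mul_cancel, weight_one]

/-- square-integrability is preserved by `f ↦ f ∘ (g • ·)` -/
theorem memLp_comp_smul {f : X → ℂ} (hf : MemLp f 2 μ) (g : G) : MemLp (fun x => f (g • x)) 2 μ := by
  have h1 : MemLp f 2 (μ.map (fun x : X => g • x)) := by
    rw [map_smul_eq μ g]
    exact hf.smul_measure ENNReal.coe_ne_top
  exact h1.comp_of_map (measurable_const_smul g).aemeasurable

/-- `‖f ∘ (g•)‖₂ = δ(g)^{-1/2} ‖f‖₂` -/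
theorem eLpNorm_comp_smul (f : X → ℂ) (hf : AEStronglyMeasurable f μ) (g : G) :
    eLpNorm (fun x => f (g • x)) 2 μ
      = (((distribHaarChar X g)⁻¹ ^ (2⁻¹ : ℝ) : ℝ≥0) : ℝ≥0∞) * eLpNorm f 2 μ := by
  have hf' : AEStronglyMeasurable f (μ.map (fun x : X => g • x)) := by
    rw [map_smul_eq μ g]; exact hf.smul_measure _
  have := eLpNorm_map_measure (p := 2) hf' (measurable_const_smul g).aemeasurable
  rw [show (f ∘ fun x : X => g • x) = fun x => f (g • x) from rfl] at this
  rw [← this, map_smul_eq μ g, eLpNorm_smul_measure_of_ne_zero' (inv_ne_zero distribHaarChar_pos.ne')]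
  simp [ENNReal.smul_def]

/-- the dilated function `x ↦ ν(g) δ(g)^{1/2} f(g • x)` of an `L²` class, as an `L²` class -/
def dilateFun (ν : G →* Circle) (g : G) (f : Lp ℂ 2 μ) : Lp ℂ 2 μ :=
  ((memLp_comp_smul μ (Lp.memLp f) g).const_smul (weight X ν g)).toLp _

/-- (Ported verbatim from the HodgeCMPerL package; no docstring in the source.) -/
theorem coeFn_dilateFun (ν : G →* Circle) (g : G) (f : Lp ℂ 2 μ) :
    ⇑(dilateFun μ ν g f) =ᵐ[μ] fun x => weight X ν g * f (g • x) :=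
  MemLp.coeFn_toLp _

/-- the dilation operator preserves the `L²` norm (this is where `δ^{1/2}` is used) -/
theorem eLpNorm_dilateFun (ν : G →* Circle) (g : G) (f : Lp ℂ 2 μ) :
    eLpNorm (dilateFun μ ν g f) 2 μ = eLpNorm f 2 μ := by
  have key : NNReal.sqrt (distribHaarChar X g) * (distribHaarChar X g)⁻¹ ^ (2⁻¹ : ℝ) = 1 := by
    rw [NNReal.sqrt_eq_rpow, one_div, ← NNReal.mul_rpow, mul_inv_cancel₀ distribHaarChar_pos.ne',
      NNReal.one_rpow]
  rw [eLpNorm_congr_ae (coeFn_dilateFun μ ν g f)]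
  rw [show (fun x => weight X ν g * f (g • x)) = weight X ν g • fun x => f (g • x) from rfl,
    eLpNorm_const_smul, eLpNorm_comp_smul μ f (Lp.aestronglyMeasurable f) g, ← mul_assoc,
    enorm_eq_nnnorm, nnnorm_weight, ← ENNReal.coe_mul, key, ENNReal.coe_one, one_mul]

/-- (Ported verbatim from the HodgeCMPerL package; no docstring in the source.) -/
theorem norm_dilateFun (ν : G →* Circle) (g : G) (f : Lp ℂ 2 μ) : ‖dilateFun μ ν g f‖ = ‖f‖ := by
  rw [Lp.norm_def, Lp.norm_def, eLpNorm_dilateFun]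

/-- (Ported verbatim from the HodgeCMPerL package; no docstring in the source.) -/
theorem dilateFun_add (ν : G →* Circle) (g : G) (f f' : Lp ℂ 2 μ) :
    dilateFun μ ν g (f + f') = dilateFun μ ν g f + dilateFun μ ν g f' := by
  apply Lp.ext
  refine (coeFn_dilateFun μ ν g _).trans (Filter.EventuallyEq.trans ?_ (Lp.coeFn_add _ _).symm)
  have h := (quasiMeasurePreserving_smul' μ g).ae_eq_comp (Lp.coeFn_add f f')
  filter_upwards [h, coeFn_dilateFun μ ν g f, coeFn_dilateFun μ ν g f'] with x hx h1 h2
  simp only [Function.comp_apply, Pi.add_apply] at hx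
  simp only [Pi.add_apply, h1, h2, hx, mul_add]

/-- (Ported verbatim from the HodgeCMPerL package; no docstring in the source.) -/
theorem dilateFun_smul (ν : G →* Circle) (g : G) (c : ℂ) (f : Lp ℂ 2 μ) :
    dilateFun μ ν g (c • f) = c • dilateFun μ ν g f := by
  apply Lp.ext
  refine (coeFn_dilateFun μ ν g _).trans (Filter.EventuallyEq.trans ?_ (Lp.coeFn_smul _ _).symm)
  have h := (quasiMeasurePreserving_smul' μ g).ae_eq_comp (Lp.coeFn_smul c f)
  filter_upwards [h, coeFn_dilateFun μ ν g f] with x hx h1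
  simp only [Function.comp_apply, Pi.smul_apply, smul_eq_mul] at hx
  simp only [Pi.smul_apply, h1, hx, smul_eq_mul]
  ring

/-- (Ported verbatim from the HodgeCMPerL package; no docstring in the source.) -/
theorem dilateFun_mul (ν : G →* Circle) (g h : G) (f : Lp ℂ 2 μ) :
    dilateFun μ ν (g * h) f = dilateFun μ ν g (dilateFun μ ν h f) := by
  apply Lp.ext
  refine (coeFn_dilateFun μ ν _ _).trans (Filter.EventuallyEq.trans ?_ (coeFn_dilateFun μ ν g _).symm)
  have hh := (quasiMeasurePreserving_smul' μ g).ae_eq_comp (coeFn_dilateFun μ ν h f)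
  filter_upwards [hh] with x hx
  simp only [Function.comp_apply] at hx
  rw [hx, weight_mul, mul_comm g h, mul_smul, mul_assoc]

/-- (Ported verbatim from the HodgeCMPerL package; no docstring in the source.) -/
theorem dilateFun_one (ν : G →* Circle) (f : Lp ℂ 2 μ) : dilateFun μ ν 1 f = f := by
  apply Lp.ext
  refine (coeFn_dilateFun μ ν _ _).trans ?_
  filter_upwards [] with x
  rw [weight_one, one_smul, one_mul]

/-- (Ported verbatim from the HodgeCMPerL package; no docstring in the source.) -/
theorem dilateFun_inv_apply (ν : G →* Circle) (g : G) (f : Lp ℂ 2 μ) :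
    dilateFun μ ν g⁻¹ (dilateFun μ ν g f) = f := by
  rw [← dilateFun_mul, inv_mul_cancel, dilateFun_one]

/-- **The dilation operator** `ω(g) : f ↦ ν(g) δ(g)^{1/2} f(g • ·)`, a unitary operator on `L²(X, μ)`. -/
def dilate (ν : G →* Circle) (g : G) : Lp ℂ 2 μ ≃ₗᵢ[ℂ] Lp ℂ 2 μ where
  toFun := dilateFun μ ν g
  map_add' := dilateFun_add μ ν g
  map_smul' := dilateFun_smul μ ν g
  invFun := dilateFun μ ν g⁻¹
  left_inv := dilateFun_inv_apply μ ν g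
  right_inv f := by simpa only [inv_inv] using dilateFun_inv_apply μ ν g⁻¹ f
  norm_map' := norm_dilateFun μ ν g

/-- (Ported verbatim from the HodgeCMPerL package; no docstring in the source.) -/
@[simp] theorem dilate_apply (ν : G →* Circle) (g : G) (f : Lp ℂ 2 μ) :
    dilate μ ν g f = dilateFun μ ν g f := rfl

/-- **The dilation representation** `ω : G →* U(L²(X, μ))`, `(ω(g) f)(x) = ν(g) δ(g)^{1/2} f(g • x)`. -/
def dilationRep (ν : G →* Circle) : G →* (Lp ℂ 2 μ ≃ₗᵢ[ℂ] Lp ℂ 2 μ) where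
  toFun := dilate μ ν
  map_one' := LinearIsometryEquiv.ext fun f => by
    rw [dilate_apply, dilateFun_one, LinearIsometryEquiv.one_def]; rfl
  map_mul' g h := LinearIsometryEquiv.ext fun f => by
    rw [LinearIsometryEquiv.coe_mul, Function.comp_apply, dilate_apply, dilate_apply, dilate_apply,
      dilateFun_mul]

/-- (Ported verbatim from the HodgeCMPerL package; no docstring in the source.) -/
theorem coeFn_dilationRep (ν : G →* Circle) (g : G) (f : Lp ℂ 2 μ) :
    ⇑(dilationRep μ ν g f) =ᵐ[μ] fun x => weight X ν g * f (g • x) :=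
  coeFn_dilateFun μ ν g f

/-- `ω(g) 𝟙_A = ν(g) δ(g)^{1/2} 𝟙_{g⁻¹ A}` -/
theorem dilationRep_indicatorConstLp (ν : G →* Circle) (g : G) {A : Set X} (hA : MeasurableSet A)
    (hμA : μ A ≠ ⊤) :
    dilationRep μ ν g (indicatorConstLp 2 hA hμA (1 : ℂ))
      = weight X ν g • indicatorConstLp 2 (hA.preimage (measurable_const_smul g))
          (measure_preimage_smul_ne_top μ g hμA) (1 : ℂ) := by
  apply Lp.ext
  refine (coeFn_dilationRep μ ν g _).trans (Filter.EventuallyEq.trans ?_ (Lp.coeFn_smul _ _).symm)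
  have h := (quasiMeasurePreserving_smul' μ g).ae_eq_comp
    (indicatorConstLp_coeFn (p := 2) (hs := hA) (hμs := hμA) (c := (1 : ℂ)))
  filter_upwards [h, indicatorConstLp_coeFn (p := 2) (μ := μ)
    (hs := hA.preimage (measurable_const_smul g))
    (hμs := measure_preimage_smul_ne_top μ g hμA) (c := (1 : ℂ))] with x hx h2
  simp only [Function.comp_apply] at hx
  rw [hx, Pi.smul_apply, h2, smul_eq_mul]
  rfl

/-- **Matrix coefficient of the dilation representation at an indicator**:
`⟪𝟙_A, ω(g) 𝟙_A⟫ = ν(g) δ(g)^{1/2} · vol(A ∩ g⁻¹A)`. -/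
theorem inner_indicator_dilationRep (ν : G →* Circle) (g : G) {A : Set X} (hA : MeasurableSet A)
    (hμA : μ A ≠ ⊤) :
    ⟪indicatorConstLp 2 hA hμA (1 : ℂ), dilationRep μ ν g (indicatorConstLp 2 hA hμA (1 : ℂ))⟫_ℂ
      = weight X ν g * (μ.real (A ∩ (fun x => g • x) ⁻¹' A) : ℂ) := by
  rw [dilationRep_indicatorConstLp, inner_smul_right,
    L2.inner_indicatorConstLp_one_indicatorConstLp_one hA _ hμA (measure_preimage_smul_ne_top μ g hμA)]
  rfl

end General

/-! ## §2  The split place: `G = Fˣ` acting on `X = Fⁿ`; the local-factor datum constructed -/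

section SplitPlace

variable {F : Type} [NormedField F] [IsUltrametricDist F] [ProperSpace F] {n : ℕ}

/-- tex l. 620 "`|y|^{3/2} ≡ 1` on `U₁`": the module of a norm-one unit acting on `Fⁿ` is `1`
(computed against the additive Haar measure of the unit ball, which a norm-one unit preserves). -/
theorem distribHaarChar_eq_one_of_norm_eq_one (n : ℕ) (y : Fˣ) (hy : ‖(y : F)‖ = 1) :
    distribHaarChar (Fin n → F) y = 1 := by
  borelize (Fin n → F)
  have h := distribHaarChar_mul (Measure.addHaar : Measure (Fin n → F)) y (closedBall (0 : Fin n → F) 1)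
  have hs : y • closedBall (0 : Fin n → F) 1 = closedBall 0 1 := by
    change (y : F) • closedBall (0 : Fin n → F) 1 = closedBall 0 1
    rw [smul_closedBall' (Units.ne_zero y), smul_zero, hy, one_mul]
  rw [hs] at h
  have h0 : (Measure.addHaar : Measure (Fin n → F)) (closedBall (0 : Fin n → F) 1) ≠ 0 :=
    (measure_closedBall_pos _ 0 one_pos).ne'
  have htop : (Measure.addHaar : Measure (Fin n → F)) (closedBall (0 : Fin n → F) 1) ≠ ⊤ :=
    (isCompact_closedBall 0 1).measure_lt_top.ne
  have h1 : ((distribHaarChar (Fin n → F) y : ℝ≥0) : ℝ≥0∞) = 1 :=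
    (ENNReal.mul_left_inj h0 htop).1 (h.trans (one_mul _).symm)
  exact_mod_cast h1

/-- the Borel σ-algebra on `Fˣ` (a local instance: the constructed datum carries it as its field `meas`) -/
@[reducible] def unitsBorel : MeasurableSpace Fˣ := borel Fˣ

attribute [local instance] unitsBorel

omit [IsUltrametricDist F] [ProperSpace F] in
/-- (Ported verbatim from the HodgeCMPerL package; no docstring in the source.) -/
theorem borelSpace_units : BorelSpace Fˣ := ⟨rfl⟩

attribute [local instance] borelSpace_units


/-- instances found (recorded): `Fˣ` is a locally compact topological group with measurable inversion and
Haar measures (`Measure.haar`; `haarMeasure K₀`). -/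
example : MeasurableInv Fˣ := inferInstance
example : LocallyCompactSpace Fˣ := inferInstance
example : (Measure.haar : Measure Fˣ).IsHaarMeasure := inferInstance

open Classical in
/-- extension by `0` of a function on `Fˣ` to a function on `F` -/
def extendUnits (f : Fˣ → ℂ) (x : F) : ℂ := if hx : x = 0 then 0 else f (Units.mk0 x hx)

omit [IsUltrametricDist F] [ProperSpace F] in
/-- (Ported verbatim from the HodgeCMPerL package; no docstring in the source.) -/
@[simp] theorem extendUnits_val (f : Fˣ → ℂ) (y : Fˣ) : extendUnits f (y : F) = f y := by
  rw [extendUnits, dif_neg (Units.ne_zero y), Units.mk0_val]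

omit [IsUltrametricDist F] [ProperSpace F] in
/-- (Ported verbatim from the HodgeCMPerL package; no docstring in the source.) -/
theorem ne_zero_of_radius {x₀ : Fin n → F} {r : ℝ} (hr : r < ‖x₀‖) (hr0 : 0 < r) : x₀ ≠ 0 := by
  rintro rfl
  rw [norm_zero] at hr
  exact lt_asymm hr hr0

/-- `U₁`, read in `Fˣ`, is compact (a closed ball of radius `< 1` about `1`, inside `𝒪^×`). -/
theorem isCompact_val_preimage_U1 {x₀ : Fin n → F} {r : ℝ} (hr : r < ‖x₀‖) (hr0 : 0 < r) :
    IsCompact ((Units.val : Fˣ → F) ⁻¹' U1 x₀ r) := by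
  refine Units.isEmbedding_val₀.isInducing.isCompact_preimage' ?_ ?_
  · rw [U1_eq_closedBall (ne_zero_of_radius hr hr0)]
    exact isCompact_closedBall _ _
  · intro y hy
    have hy0 : y ≠ 0 := norm_ne_zero_iff.mp (by rw [norm_eq_one_of_mem_U1 hr hy]; exact one_ne_zero)
    exact ⟨Units.mk0 y hy0, rfl⟩

omit [ProperSpace F] in
/-- (Ported verbatim from the HodgeCMPerL package; no docstring in the source.) -/
theorem measurableSet_val_preimage_U1 (x₀ : Fin n → F) {r : ℝ} (hr0 : 0 < r) :
    MeasurableSet ((Units.val : Fˣ → F) ⁻¹' U1 x₀ r) :=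
  ((isOpen_U1 hr0).preimage Units.continuous_val).measurableSet

/-- on `U₁` the weight `ν(y)|y|^{n/2}` is `1` (tex l. 620: `U₁ ⊂ ker`, `|y|^{3/2} ≡ 1` on `U₁`). -/
theorem extendUnits_weight_eq_one (ν : Fˣ →* Circle) {x₀ : Fin n → F} {r : ℝ} (hr : r < ‖x₀‖)
    (hν : ∀ y : Fˣ, (y : F) ∈ U1 x₀ r → ν y = 1) :
    ∀ x ∈ U1 x₀ r, extendUnits (weight (Fin n → F) ν) x = 1 := by
  intro x hx
  have hx1 : ‖x‖ = 1 := norm_eq_one_of_mem_U1 hr hx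
  have hx0 : x ≠ 0 := norm_ne_zero_iff.mp (by rw [hx1]; exact one_ne_zero)
  have h1 := extendUnits_val (weight (Fin n → F) ν) (Units.mk0 x hx0)
  rw [Units.val_mk0] at h1
  rw [h1, weight, hν (Units.mk0 x hx0) hx, distribHaarChar_eq_one_of_norm_eq_one n (Units.mk0 x hx0) hx1]
  simp

omit [ProperSpace F] in
/-- on `U₁` the character `χ'_v` is `1` ("N so large that `U₁ ⊂ ker χ'`"). -/
theorem extendUnits_char_eq_one (χ' : Fˣ →* Circle) {x₀ : Fin n → F} {r : ℝ} (hr : r < ‖x₀‖)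
    (hχ : ∀ y : Fˣ, (y : F) ∈ U1 x₀ r → χ' y = 1) :
    ∀ x ∈ U1 x₀ r, extendUnits (fun y => (χ' y : ℂ)) x = 1 := by
  intro x hx
  have hx1 : ‖x‖ = 1 := norm_eq_one_of_mem_U1 hr hx
  have hx0 : x ≠ 0 := norm_ne_zero_iff.mp (by rw [hx1]; exact one_ne_zero)
  have h1 := extendUnits_val (fun y => (χ' y : ℂ)) (Units.mk0 x hx0)
  rw [Units.val_mk0] at h1
  rw [h1, hχ (Units.mk0 x hx0) hx, Circle.coe_one]

variable [MeasurableSpace (Fin n → F)] [BorelSpace (Fin n → F)] (μV : Measure (Fin n → F)) [μV.IsAddHaarMeasure]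

/-- instance found (recorded): an additive Haar measure on `Fⁿ` is regular (second countable, locally compact). -/
example : μV.Regular := inferInstance

variable (x₀ : Fin n → F) (r : ℝ)

/-- `φ_v = 1_D`, `D = closedBall x₀ r`, as an element of `L²(Fⁿ)` -/
def ballIndicator : Lp ℂ 2 μV :=
  indicatorConstLp 2 (measurableSet_closedBall (x := x₀) (ε := r))
    (isCompact_closedBall x₀ r).measure_lt_top.ne (1 : ℂ)

variable (μG : Measure Fˣ) [μG.IsHaarMeasure] [μG.Regular] (ν χ' : Fˣ →* Circle)

/-- instances found (recorded): a regular Haar measure on `Fˣ` is inversion-invariant (`Fˣ` commutative);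
`Measure.haar` and `haarMeasure K₀` are regular Haar measures. -/
example : μG.IsInvInvariant := inferInstance
example : (Measure.haar : Measure Fˣ).Regular := inferInstance
example (K₀ : TopologicalSpace.PositiveCompacts Fˣ) : (Measure.haarMeasure K₀).Regular := inferInstance


-- port_pkg: scope closed for this part
end SplitPlace
end DilationModel
end LocalFactors
end PerL34
end HodgeCM
end
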